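import Literature.Analysis.Fourier.ErdosTuranInequality
import Literature.NumberTheory.DiophantineApproximation.LeVequeInequality
import Mathlib.Tactic
import HarnessLib

/-!
# The Erdős–Turán bound for the box discrepancy

Calegari–Dimitrov–Tang, arXiv:2408.15403, §4.2 (p. 42), quote the Erdős–Turán inequality
`D(t) ≤ 3 (1/(K+1) + Σ_{k=1}^{K} |S_k(t)|/(k n))` (Drmota–Tichy) for the box discrepancy of
Definition 44 and use it, together with Hoeffding's inequality, for Theorem 45. This file
derives the box-discrepancy form from the Erdős–Turán inequality of
`Literature.Analysis.Fourier.ErdosTuranInequality` (Travaglini's Theorem 7.3 with explicit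
absolute constants): `D_N(y) ≤ 802/H + (2/π + 1600) (1/N) Σ_{d=1}^{H} |S_d|/d`.
(Unrelated to the tree's `Literature.Analysis.Fourier.ErdosTuranDiscrepancy`, which is the
Murty–Sinha variant of Erdős–Turán against a density, by Fejér smoothing.)

* `weylSum_eq_expSum` — the Weyl sums of `LeVequeInequality` are the `expSum`s.
* `boxDiscrepancy_le_erdosTuran` — **Erdős–Turán for `boxDiscrepancy`**.

No named facts.

## References

* [CalegariDimitrovTang2024] arXiv:2408.15403, §4.1 Definition 44, §4.2 (p. 42).
* [Travaglini2014] Thm 7.3.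
-/

noncomputable section

namespace Literature.NumberTheory.DiophantineApproximation

namespace Discrepancy

open Literature.Analysis.Fourier.TrigApprox Real

variable {N : ℕ}

/-- The Weyl sums of `LeVequeInequality` are the exponential sums `S(d)` of
`ErdosTuranInequality`. [folklore] -/
theorem weylSum_eq_expSum (y : Fin N → ℝ) (d : ℤ) : weylSum y d = expSum y d := by
  unfold weylSum expSum Literature.Analysis.Fourier.TrigApprox.e
  refine Finset.sum_congr rfl fun n _ => ?_
  congr 1; push_cast; ring

/-- **The Erdős–Turán bound for the box discrepancy** (CDT Definition 44): for points
`y₁,…,y_N ∈ [0,1)` and every `H ≥ 1`,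
`D_N(y) ≤ 802/H + (2/π + 1600) · (1/N) Σ_{d=1}^{H} |S_d|/d`, `S_d = Σ_n e(d y_n)` — the
inequality `D ≤ 3(1/(K+1) + Σ_{k≤K} |S_k|/(kn))` quoted in CDT §4.2 (from Drmota–Tichy), with a
cruder absolute constant.
[cite: CalegariDimitrovTang2024, §4.2 eq. (Erdős–Turán) (p. 42); Travaglini2014, Thm 7.3] -/
theorem boxDiscrepancy_le_erdosTuran (y : Fin N → ℝ) (hN : 0 < N) (hy0 : ∀ n, 0 ≤ y n)
    (hy1 : ∀ n, y n < 1) {H : ℕ} (hH : 1 ≤ H) :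
    boxDiscrepancy y ≤ 802 / H + (2 / π + 1600) * ((∑ d ∈ Finset.Icc 1 H, ‖weylSum y d‖ / d) / N) := by
  have hNR : (0 : ℝ) < N := by exact_mod_cast hN
  unfold boxDiscrepancy
  refine csSup_le ?_ ?_
  · exact ⟨_, ⟨(0, 0), ⟨le_rfl, le_rfl, zero_le_one⟩, rfl⟩⟩
  · rintro _ ⟨⟨a, b⟩, ⟨ha, hab, hb⟩, rfl⟩
    simp only
    unfold localDisc
    have hET := erdosTuran_closed y ha hab hb hH
    -- `fract (y n) = y n`
    have hfilter : (Finset.univ.filter fun n => a ≤ Int.fract (y n) ∧ Int.fract (y n) ≤ b) =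
        (Finset.univ.filter fun n => a ≤ y n ∧ y n ≤ b) := by
      refine Finset.filter_congr fun n _ => ?_
      rw [Int.fract_eq_self.mpr ⟨hy0 n, hy1 n⟩]
    rw [hfilter] at hET
    simp_rw [weylSum_eq_expSum]
    -- divide by `N`
    have hkey : |(b - a) - ((Finset.univ.filter fun n => a ≤ y n ∧ y n ≤ b).card : ℝ) / N| =
        |(((Finset.univ.filter fun n => a ≤ y n ∧ y n ≤ b).card : ℝ)) - (b - a) * N| / N := by
      rw [abs_sub_comm (((Finset.univ.filter fun n => a ≤ y n ∧ y n ≤ b).card : ℝ)) _,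
        show (b - a) - ((Finset.univ.filter fun n => a ≤ y n ∧ y n ≤ b).card : ℝ) / N =
          ((b - a) * N - ((Finset.univ.filter fun n => a ≤ y n ∧ y n ≤ b).card : ℝ)) / N by
          field_simp, abs_div, abs_of_pos hNR]
    rw [hkey, div_le_iff₀ hNR]
    refine hET.trans (le_of_eq ?_)
    field_simp

end Discrepancy

end Literature.NumberTheory.DiophantineApproximation
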